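import Summits.CriticalPhenomena.CardyFormulaZ2.Theorems.ParafermionFamiliesToSLESix.Negative.ConclusionNeedsAdmissibility

/-!
# `ParafermionFamiliesToSLESix` (route `CardySusyWard`, stmt-CriticalPhenomena-10814): Hausdorff
# convergence of BOTH arcs does not control the discrete arcs

Negative-side support (cdisprove unit, cycle 1), sequel to `ConclusionNeedsAdmissibility.lean`.
There the conclusion of the crux was shown false once eventual admissibility, marks convergence and
the dual-arc convergence are dropped. Here the dual-arc convergence is KEPT:
`conclusion_false_without_marks_and_admissibility` — for every Dobrushin-data family with the right
carrier and mesh whose wired arcs converge to `(ab)` AND whose dual-wired arcs converge to `(ba)` in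
Hausdorff distance, SLE₆ convergence of the interface still FAILS in general. Witness on the unit
disc: wired arc `(ab)` itself, dual-wired arc the lower half circle pushed out to radius `1 + δ`
(within Hausdorff distance `δ` of `(ba)`, `hausdorffEDist_image_mul_arc_le`); since every site of
`Ω_δ` is strictly closer to the unit circle than to the pushed-out arc, the discrete arc `B` is
EMPTY at every positive mesh (`zdArcB_eq_empty_of_norm_eq`), so there is no `A`–`B` edge, no
exploration path, and the interface functional is the junk constant curve `0`
(`target_iface_eq_zero_of_norm_eq`), which never converges to chordal SLE₆
(`not_convergesInLawToSLE_of_target_eq`). Lesson: in the family-form vocabulary the two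
arc-convergence fields do not control `zdArcA`/`zdArcB`; the load-bearing inner side conditions of
the conclusion are marks convergence and eventual admissibility.
-/

noncomputable section

namespace Summit.CriticalPhenomena.CardyFormulaZ2.Theorems.ParafermionFamiliesToSLESix.Negative

open scoped Topology NNReal unitInterval ENNReal
open Filter MeasureTheory Set
open Literature.Probability.LatticeModels Literature.Probability.Percolation
open Literature.Probability.RandomPlanarGeometry
open Summit.CriticalPhenomena.CardyFormulaZ2.Theses.CardySusyWard

/-- Points of the unit-disc arcs have norm `1`. [folklore] -/
theorem norm_eq_one_of_mem_unitDisc_arc {z : ℂ} {i : Fin 2} (hz : z ∈ DobrushinDomain.unitDisc.arc i) :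
    ‖z‖ = 1 := by
  have h := DobrushinDomain.unitDisc.arc_subset_frontier i hz
  change z ∈ frontier (Metric.ball (0:ℂ) 1) at h
  rw [frontier_ball (0:ℂ) one_ne_zero] at h
  simpa using h

/-- An interior point `p` of the disc is within `1 - ‖p‖` of the unit circle minus any set
avoiding the circle (radial projection; the point `1` if `p = 0`). [folklore] -/
theorem infDist_sphere_diff_le {p : ℂ} (hp : ‖p‖ < 1) {S : Set ℂ} (hS : ∀ w ∈ S, ‖w‖ ≠ 1) :
    Metric.infDist p (Metric.sphere (0:ℂ) 1 \ S) ≤ 1 - ‖p‖ := by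
  by_cases hp0 : p = 0
  · subst hp0
    have h1 : (1:ℂ) ∈ Metric.sphere (0:ℂ) 1 \ S := ⟨by simp, fun h => hS 1 h (by simp)⟩
    have h2 := Metric.infDist_le_dist_of_mem (x := (0:ℂ)) h1
    simpa using h2
  · have hnp : (0:ℝ) < ‖p‖ := norm_pos_iff.2 hp0
    set q : ℂ := ((‖p‖⁻¹ : ℝ) : ℂ) * p with hq
    have hqn : ‖q‖ = 1 := by
      rw [hq, norm_mul, Complex.norm_real, Real.norm_eq_abs, abs_of_pos (inv_pos.2 hnp),
        inv_mul_cancel₀ hnp.ne']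
    have hqmem : q ∈ Metric.sphere (0:ℂ) 1 \ S := ⟨by simpa using hqn, fun h => hS q h hqn⟩
    have hdist : dist p q = 1 - ‖p‖ := by
      rw [dist_eq_norm, hq]
      have : p - ((‖p‖⁻¹ : ℝ) : ℂ) * p = ((1 - ‖p‖⁻¹ : ℝ) : ℂ) * p := by push_cast; ring
      rw [this, norm_mul, Complex.norm_real, Real.norm_eq_abs]
      have h1 : 1 - ‖p‖⁻¹ ≤ 0 := by
        rw [sub_nonpos]
        exact one_le_inv_iff₀.2 ⟨hnp, hp.le⟩
      rw [abs_of_nonpos h1]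
      field_simp
      ring
    calc Metric.infDist p (Metric.sphere (0:ℂ) 1 \ S) ≤ dist p q := Metric.infDist_le_dist_of_mem hqmem
      _ = 1 - ‖p‖ := hdist

/-- **Pushed-out dual arcs have an empty discrete arc.** On the unit disc at mesh `δ > 0`, if every
point of the dual-wired arc `B` (nonempty) has norm `1 + δ`, then `zdArcB = ∅`: a site `p` of `Ω_δ`
is at distance `≥ 1 + δ - ‖p‖` from `B` but `≤ 1 - ‖p‖` from `∂𝔻 ∖ B = ∂𝔻`. [folklore] -/
theorem zdArcB_eq_empty_of_norm_eq {δ : ℝ} (hδ : 0 < δ) {A B : Set ℂ} (hB : B.Nonempty)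
    (hBn : ∀ w ∈ B, ‖w‖ = 1 + δ) :
    (⟨Metric.ball (0:ℂ) 1, δ, A, B⟩ : DiscreteDobrushin).zdArcB = ∅ := by
  ext x
  simp only [Set.mem_empty_iff_false, iff_false]
  intro hx
  have hx' : x ∈ DiscreteDobrushin.zdDiscreteArc ⟨Metric.ball (0:ℂ) 1, δ, A, B⟩ B := hx
  rw [DiscreteDobrushin.mem_zdDiscreteArc_iff] at hx'
  obtain ⟨hxb, hle⟩ := hx'
  change Metric.infDist (meshPoint δ x) B ≤
    Metric.infDist (meshPoint δ x) (frontier (Metric.ball (0:ℂ) 1) \ B) at hle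
  have hxΩ : meshPoint δ x ∈ Metric.ball (0:ℂ) 1 :=
    meshDomain_subset_meshVertices _ _ (DiscreteDobrushin.zdBoundary_subset_meshDomain _ hxb)
  have hp : ‖meshPoint δ x‖ < 1 := by simpa using hxΩ
  have hS : ∀ w ∈ B, ‖w‖ ≠ 1 := fun w hw => by rw [hBn w hw]; linarith
  rw [frontier_ball (0:ℂ) one_ne_zero] at hle
  have h1 := infDist_sphere_diff_le hp hS
  have h2 : 1 + δ - ‖meshPoint δ x‖ ≤ Metric.infDist (meshPoint δ x) B := by
    rw [Metric.le_infDist hB]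
    intro w hw
    have := norm_sub_norm_le w (meshPoint δ x)
    rw [hBn w hw] at this
    rw [dist_comm, dist_eq_norm]; linarith
  linarith

/-- Hence such data have no `A`–`B` edge, no exploration path, and the interface functional of the
conclusion (written verbatim) ends at `0`. [folklore] -/
theorem target_iface_eq_zero_of_norm_eq {δ : ℝ} (hδ : 0 < δ) {A B : Set ℂ} (hB : B.Nonempty)
    (hBn : ∀ w ∈ B, ‖w‖ = 1 + δ) (ω : BondConfig (Site 2)) :
    (CurveClass.mk
      (if dist (medialExplorationCurve (⟨Metric.ball (0:ℂ) 1, δ, A, B⟩ : DiscreteDobrushin) ω 0)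
            (DobrushinDomain.unitDisc.pt 0) ≤
          dist (medialExplorationCurve (⟨Metric.ball (0:ℂ) 1, δ, A, B⟩ : DiscreteDobrushin) ω 0)
            (DobrushinDomain.unitDisc.pt 1)
        then (⟨medialExplorationCurve (⟨Metric.ball (0:ℂ) 1, δ, A, B⟩ : DiscreteDobrushin) ω⟩ : Curve ℂ)
        else ⟨(medialExplorationCurve (⟨Metric.ball (0:ℂ) 1, δ, A, B⟩ : DiscreteDobrushin) ω).comp
          ⟨unitInterval.symm, unitInterval.continuous_symm⟩⟩)).target = 0 := by
  have hAB : (⟨Metric.ball (0:ℂ) 1, δ, A, B⟩ : DiscreteDobrushin).zdABEdges = ∅ := by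
    ext e
    simp [DiscreteDobrushin.mem_zdABEdges_iff, zdArcB_eq_empty_of_norm_eq hδ hB hBn]
  have hnil : medialExploration (⟨Metric.ball (0:ℂ) 1, δ, A, B⟩ : DiscreteDobrushin) ω = [] := by
    rcases medialExploration_eq_nil_or (⟨Metric.ball (0:ℂ) 1, δ, A, B⟩ : DiscreteDobrushin) ω
      with h | h
    · exact h
    · exfalso
      have := h.head_mem
      rw [hAB] at this
      exact this
  rw [medialExplorationCurve, hnil, List.map_nil, polyline_nil]
  split_ifs <;> rfl

/-- The lower half circle pushed out to radius `1 + δ` is within Hausdorff distance `δ` of `(ba)`.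
[folklore] -/
theorem hausdorffEDist_image_mul_arc_le {δ : ℝ} (hδ : 0 ≤ δ) :
    Metric.hausdorffEDist ((fun z : ℂ => ((1 + δ : ℝ) : ℂ) * z) '' DobrushinDomain.unitDisc.arc 1)
      (DobrushinDomain.unitDisc.arc 1) ≤ ENNReal.ofReal δ := by
  have key : ∀ z ∈ DobrushinDomain.unitDisc.arc 1, dist (((1 + δ : ℝ) : ℂ) * z) z ≤ δ := by
    intro z hz
    rw [dist_eq_norm, show ((1 + δ : ℝ) : ℂ) * z - z = ((δ:ℝ):ℂ) * z by push_cast; ring, norm_mul,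
      norm_eq_one_of_mem_unitDisc_arc hz, mul_one, Complex.norm_real, Real.norm_eq_abs,
      abs_of_nonneg hδ]
  apply Metric.hausdorffEDist_le_of_mem_edist
  · rintro _ ⟨z, hz, rfl⟩
    refine ⟨z, hz, ?_⟩
    rw [edist_dist]
    exact ENNReal.ofReal_le_ofReal (key z hz)
  · intro z hz
    refine ⟨_, ⟨z, hz, rfl⟩, ?_⟩
    rw [edist_dist, dist_comm]
    exact ENNReal.ofReal_le_ofReal (key z hz)

/-- **Arc convergence (both arcs) does not make the conclusion true**: with the carrier, mesh,
`arcA → (ab)` AND `arcB → (ba)` conditions kept and only marks convergence and eventual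
admissibility dropped, the conclusion of the crux is FALSE — witness the pushed-out-arc family on
the unit disc. [folklore] -/
theorem conclusion_false_without_marks_and_admissibility :
    ¬ ∀ (D : DobrushinDomain) (Λ : ℝ → DiscreteDobrushin), (∀ δ, (Λ δ).Ω = D.carrier) →
        (∀ δ, (Λ δ).δ = δ) →
        Tendsto (fun δ : ℝ => Metric.hausdorffEDist (Λ δ).arcA (D.arc 0)) (𝓝[>] (0:ℝ)) (𝓝 0) →
        Tendsto (fun δ : ℝ => Metric.hausdorffEDist (Λ δ).arcB (D.arc 1)) (𝓝[>] (0:ℝ)) (𝓝 0) →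
        ConvergesInLawToSLE 6 D (Ωδ := fun _ => BondConfig (Site 2))
          (fun δ ω => CurveClass.mk
            (if dist (medialExplorationCurve (Λ δ) ω 0) (D.pt 0) ≤
                dist (medialExplorationCurve (Λ δ) ω 0) (D.pt 1)
              then (⟨medialExplorationCurve (Λ δ) ω⟩ : Curve ℂ)
              else ⟨(medialExplorationCurve (Λ δ) ω).comp
                ⟨unitInterval.symm, unitInterval.continuous_symm⟩⟩))
          (fun _ => bondPercolation (zdGraph 2) half) := by
  intro h
  have h0 : Tendsto (fun δ : ℝ => ENNReal.ofReal δ) (𝓝[>] (0:ℝ)) (𝓝 0) := by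
    have : Tendsto (fun δ : ℝ => ENNReal.ofReal δ) (𝓝 (0:ℝ)) (𝓝 (ENNReal.ofReal 0)) :=
      ENNReal.tendsto_ofReal tendsto_id
    rw [ENNReal.ofReal_zero] at this
    exact this.mono_left nhdsWithin_le_nhds
  have key := h DobrushinDomain.unitDisc
    (fun δ : ℝ => (⟨Metric.ball (0:ℂ) 1, δ, DobrushinDomain.unitDisc.arc 0,
      (fun z : ℂ => ((1 + δ : ℝ) : ℂ) * z) '' DobrushinDomain.unitDisc.arc 1⟩ : DiscreteDobrushin))
    (fun _ => rfl) (fun _ => rfl)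
    (by
      simp only [Metric.hausdorffEDist_self]
      exact tendsto_const_nhds)
    (by
      refine tendsto_of_tendsto_of_tendsto_of_le_of_le' tendsto_const_nhds h0
        (Eventually.of_forall fun δ => bot_le) ?_
      filter_upwards [self_mem_nhdsWithin] with δ hδ
      exact hausdorffEDist_image_mul_arc_le (le_of_lt hδ))
  refine not_convergesInLawToSLE_of_target_eq (t₀ := 0) unitDisc_pt_one_ne_zero.symm ?_ key
  intro δ hδ ω
  have hB : ((fun z : ℂ => ((1 + δ : ℝ) : ℂ) * z) '' DobrushinDomain.unitDisc.arc 1).Nonempty :=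
    ⟨_, DobrushinDomain.unitDisc.pt 1, DobrushinDomain.unitDisc.pt_mem_arc_self 1, rfl⟩
  have hBn : ∀ w ∈ (fun z : ℂ => ((1 + δ : ℝ) : ℂ) * z) '' DobrushinDomain.unitDisc.arc 1,
      ‖w‖ = 1 + δ := by
    rintro _ ⟨z, hz, rfl⟩
    rw [norm_mul, norm_eq_one_of_mem_unitDisc_arc hz, mul_one, Complex.norm_real, Real.norm_eq_abs,
      abs_of_nonneg (by linarith)]
  exact target_iface_eq_zero_of_norm_eq hδ hB hBn ω

end Summit.CriticalPhenomena.CardyFormulaZ2.Theorems.ParafermionFamiliesToSLESix.Negative
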